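import Summits.HodgeConjecture.CorCM.MumfordTateRankAtMostThree
import Summits.HodgeConjecture.CorCM.MumfordTateRankTwo
import Summits.HodgeConjecture.CorCM.QuadraticCMFamiliesHodge
import Literature.AlgebraicGeometry.Motives.MumfordTateRankThree
import Literature.AlgebraicGeometry.HodgeTheory.CMTypeIffCentralizerCommutative
import Literature.AlgebraicGeometry.ComplexMultiplication.EndFieldTotallyRealOrCMOfRiemann
import Literature.AlgebraicGeometry.Milne1999.LefschetzCentraliserBiproducts
import HarnessLib

/-!
# The third rung of the Mumford–Tate rank ladder: `dim MT(H¹(X)) ≤ 3` forces complex multiplication;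
# `dim MT(H¹(X)) = 3` iff `X ∼ S^m` (`S` a simple CM surface) or `X ∼ E₁^a × E₂^b` (two non-isogenous CM elliptic curves)

COR-CM (cell `pub-hodgecm2`, seat `b27` gen 29, count-neutral lane MT-RANK-THREE; theorems only, no definition, no
named fact; UNCONDITIONAL).  Sequel of `CorCM/MumfordTateRankTwo` (gen 28: `2 ≤ dim MT(H¹(X))`, `= 2 ⟺ X ∼ E^g` with
`E` CM, non-CM ⟹ `≥ 3`) and `CorCM/MumfordTateRankAtMostThree` (gen 28: for `X` OF CM TYPE, `dim MT ≤ 3` ⟹ stably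
nondegenerate).  Here the CM hypothesis is REMOVED: for an ARBITRARY complex abelian variety `X`,

* §1 `isOfCMType_of_mumfordTateLieAlgebra_le_endAlg` — **if the Mumford–Tate Lie algebra of `H¹(X)` consists of Hodge
  endomorphisms then `X` is of CM type** (Green–Griffiths–Kerr Ch. V: «`M(ℚ) ⊆ End(V, φ)` ⟹ CM», infinitesimally).
  Proof: the commutant of `End_Hdg(H¹)` in `End_ℚ H¹(X(ℂ); ℚ)` is then commutative
  (`HodgeStructure.commute_of_forall_commute_endAlg`), `End_Hdg(H¹)` is the `ℚ`-span of the pull-backs `u^*`,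
  `u ∈ End X` (Riemann's theorem, fullness: `deligneMilne1982_Thm_6_20_full_holds`), so the commutant of the `u^*`
  is commutative — the hypothesis of the tree's criterion `isOfCMType_of_centralizer_bettiCohomology_comm`
  (Deligne I 5.1 / Milne 1999 Rem. 1.10 / Lange 7.2.6).
* §2 **`isOfCMType_of_mtRank_hodge_one_le_three`: `dim MT(H¹(X)) ≤ 3` ⟹ `X` is of CM type** (the abstract
  `HodgeStructure.mumfordTateLieAlgebra_le_endAlg_of_mtRank_le_three`: root components of `𝔪𝔱_ℂ` come in conjugate
  pairs); **`four_le_mtRank_hodge_one_of_not_isOfCMType`: a NON-CM abelian variety has `dim MT(H¹(X)) ≥ 4`** — sharp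
  (`MT(H¹(E^g)) = GL₂` for `E` a non-CM elliptic curve); `isOfCMType_of_mtRank_hodge_one_eq_three`.
* §3 the rank-`3` rung: `mtRank_hodge_one_eq_three_iff` — **`dim MT(H¹(X)) = 3` iff `X` is isogenous to a product of
  copies of simple, pairwise non-isogenous CM abelian varieties of TOTAL dimension `2`** (one simple CM surface, or
  two non-isogenous CM elliptic curves; `⟹` by gen 28's `exists_sum_dim_eq_two_of_mtRank_hodge_one_eq_three` now
  that `X` is CM, `⟸` by Ribet's bound `4 · rdim ≤ 2^{dim MT}` and `dim MT ≤ rdim + 1`); the two families explicitly: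
  `mtRank_hodge_one_eq_three_of_isIsogenous_powSucc_surface` (`X ∼ S^{N+1}`, `S` a simple CM surface) and
  `mtRank_hodge_one_eq_card_add_one_of_isIsogenous_biproduct_elliptic` (**`X ∼ ∏_c E_c^{m_c}` for pairwise
  non-isogenous CM elliptic curves `E_c` has `dim MT(H¹(X)) = #C + 1`**; `#C = 2` gives rank `3`).
* §4 **the Hodge conjecture for every power of every complex abelian variety with `dim MT(H¹(X)) ≤ 3`**, now
  WITHOUT a CM hypothesis (`isDivisorGenerated_powSucc_of_mtRank_hodge_one_le_three`,
  `hodgeConjectureFor_powSucc_of_mtRank_le_three`, instance-free primed form, class-target display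
  `hcOnClass_mtRank_hodge_one_le_three`).

## References

* [Deligne1982HodgeCycles] P. Deligne, *Hodge cycles on abelian varieties*, LNM 900 (1982), I Prop. 3.4, Ex. 3.7, §5
  Prop. 5.1 («A is of CM-type if its Mumford–Tate group is commutative … E is the commutant of G in End(H₁(A,ℚ))»).
* [DeligneMilne1982Tannakian] P. Deligne, J. S. Milne, *Tannakian Categories*, LNM 900 (1982), §6 Thm. 6.20 (Riemann).
* [GreenGriffithsKerr2012] M. Green, P. Griffiths, M. Kerr, *Mumford–Tate Groups and Domains* (2012), Ch. V p. 20,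
  (V.2)–(V.3).
* [Milne1999] J. S. Milne, *Lefschetz motives and the Tate conjecture*, Compositio Math. 117 (1999),
  Rem. 1.10.
* [MoonenZarhin1999LowDim] B. Moonen, Yu. Zarhin, *Hodge classes on abelian varieties of low dimension*, Math. Ann. 315
  (1999), §2.
* [Gordon1999HodgeAVSurvey] B. B. Gordon, *A survey of the Hodge conjecture for abelian varieties* (1999), 7.4–7.7, 9.1.
* [Dodson1987] B. Dodson, *On the Mumford–Tate group of an abelian variety with complex multiplication*, J. Algebra 111
  (1987), Thm. 1.0 (iii).
-/

noncomputable section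

open scoped TensorProduct
open CategoryTheory CategoryTheory.Limits NumberField Module
open scoped BigOperators

namespace Summit.HodgeConjecture.CorCM

open Literature.NumberTheory.ComplexMultiplication
open Literature.AlgebraicGeometry.Motives
open Literature.AlgebraicGeometry.Motives.AbelianVariety
open Literature.AlgebraicGeometry.Motives.HodgeStructure
open Literature.AlgebraicGeometry.HodgeTheory
open Literature.AlgebraicGeometry.ComplexMultiplication
open Literature.AlgebraicGeometry.Milne1999 (IsOfCMType isIsogeny_biproduct_map)
open Literature.AlgebraicGeometry.Pohlmann1968

/-! ## §1 If the Mumford–Tate Lie algebra of `H¹(X)` consists of Hodge endomorphisms then `X` is of CM type -/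

section Criterion

variable [HodgeTensorFacts.{0, 0}] {X : AbelianVariety ℂ} {n : ℕ}

omit [HodgeTensorFacts.{0, 0}] in
/-- **Riemann fullness on `End_Hdg(H¹(X))`**: every Hodge endomorphism `a` of `H¹(X(ℂ); ℚ)` is a rational multiple of
a pull-back, `u^* = k • a` with `u ∈ End X`, `k ≥ 1` (Deligne–Milne Thm. 6.20, the tree's theorem
`deligneMilne1982_Thm_6_20_full_holds`, through `isHodgeMorphismOne_of_map_F_le`).
[cite: DeligneMilne1982Tannakian, §6 Thm. 6.20 (Riemann)] -/
theorem exists_hom_bettiMap_eq_smul_of_mem_endAlg (hX : IsSmoothProjective n X.X) {a : Module.End ℚ (bettiCohomology X.X 1)}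
    (ha : a ∈ (BettiUniverse.hodge exists_isReal_hodgeModel_holds hX 1).endAlg) :
    ∃ (u : X ⟶ X) (k : ℕ), 0 < k ∧ (bettiCohomology.map u.hom.hom.hom 1).hom = (k : ℚ) • a := by
  have hn : X.dim = n := Literature.AlgebraicGeometry.Motives.schemeDim_eq_holds hX
  subst hn
  obtain ⟨u, k, hk, hu⟩ := deligneMilne1982_Thm_6_20_full_holds X X a
    ⟨BettiUniverse.realHodgeModel exists_isReal_hodgeModel_holds hX⟩
    (isHodgeMorphismOne_of_map_F_le exists_isReal_hodgeModel_holds hodgePQ_independent_of_hodgeModel_holds a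
      ((mem_endAlg_iff _ a).1 ha))
  refine ⟨u, k, hk, LinearMap.ext fun v => ?_⟩
  rw [LinearMap.smul_apply, Nat.cast_smul_eq_nsmul]
  exact hu v

omit [HodgeTensorFacts.{0, 0}] in
/-- **An endomorphism of `H¹(X(ℂ); ℚ)` commuting with every pull-back `u^*`, `u ∈ End X`, commutes with every Hodge
endomorphism** (fullness: `End_Hdg(H¹(X)) = ℚ · {u^*}`). [cite: DeligneMilne1982Tannakian, §6 Thm. 6.20 (Riemann)] -/
theorem commute_endAlg_of_forall_commute_bettiMap (hX : IsSmoothProjective n X.X) {x : Module.End ℚ (bettiCohomology X.X 1)}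
    (hx : ∀ u : X ⟶ X, (bettiCohomology.map u.hom.hom.hom 1).hom * x = x * (bettiCohomology.map u.hom.hom.hom 1).hom)
    {a : Module.End ℚ (bettiCohomology X.X 1)} (ha : a ∈ (BettiUniverse.hodge exists_isReal_hodgeModel_holds hX 1).endAlg) :
    x * a = a * x := by
  obtain ⟨u, k, hk, hu⟩ := exists_hom_bettiMap_eq_smul_of_mem_endAlg hX ha
  have h := hx u
  rw [hu, smul_mul_assoc, mul_smul_comm] at h
  have hk' : (k : ℚ) ≠ 0 := by exact_mod_cast hk.ne'
  exact (smul_right_injective (Module.End ℚ (bettiCohomology X.X 1)) hk' h).symm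

/-- **If `𝔪𝔱(H¹(X)) ⊆ End_Hdg(H¹(X))` then `X` is of CM type** — the Lie-algebra form of «`M(ℚ) ⊆ End(V, φ)` ⟹ `V` is a
CM-Hodge structure» (Green–Griffiths–Kerr, Ch. V) for `H¹` of a complex abelian variety.  Proof: an endomorphism of
`H¹(X(ℂ); ℚ)` commuting with all the `u^*` commutes with `End_Hdg` (fullness), hence — as `Lie Hdg ⊆ 𝔪𝔱 ⊆ End_Hdg` —
is itself a Hodge endomorphism (`HodgeStructure.mem_endAlg_of_forall_commute_endAlg`); so the commutant of the
`u^*` is commutative, and Deligne I 5.1 in the tree's form `isOfCMType_of_centralizer_bettiCohomology_comm` concludes.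
[cite: GreenGriffithsKerr2012, Ch. V p. 20 and (V.2)] [cite: Deligne1982HodgeCycles, I §5 Prop. 5.1]
[cite: Milne1999, §1 Remark 1.10 (p. 53)] -/
theorem isOfCMType_of_mumfordTateLieAlgebra_le_endAlg (hX : IsSmoothProjective n X.X)
    (hle : haveI := BettiUniverse.finite hX 1
      (BettiUniverse.hodge exists_isReal_hodgeModel_holds hX 1).mumfordTateLieAlgebra ≤
        Subalgebra.toSubmodule (BettiUniverse.hodge exists_isReal_hodgeModel_holds hX 1).endAlg) :
    IsOfCMType X := by
  haveI := BettiUniverse.finite hX 1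
  refine isOfCMType_of_centralizer_bettiCohomology_comm (A := X) Set.univ fun x y hx hy => ?_
  exact commute_of_forall_commute_endAlg _ hle
    (fun a ha => commute_endAlg_of_forall_commute_bettiMap hX (fun u => hx u (Set.mem_univ u)) ha)
    (fun a ha => commute_endAlg_of_forall_commute_bettiMap hX (fun u => hy u (Set.mem_univ u)) ha)

end Criterion

/-! ## §2 `dim MT(H¹(X)) ≤ 3` ⟹ `X` is of CM type; non-CM ⟹ `dim MT(H¹(X)) ≥ 4` -/

section RankThree

variable [HodgeTensorFacts.{0, 0}] {X : AbelianVariety ℂ} {n : ℕ}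

/-- **`dim MT(H¹(X)) ≤ 3` ⟹ `X` is of CM type**, for EVERY complex abelian variety `X`: the Mumford–Tate Lie algebra
of a Hodge structure of non-zero weight with `dim ≤ 3` consists of Hodge endomorphisms
(`HodgeStructure.mumfordTateLieAlgebra_le_endAlg_of_mtRank_le_three`), and §1.
[cite: GreenGriffithsKerr2012, Ch. V p. 20 and (V.2)–(V.3)] [cite: Deligne1982HodgeCycles, I Prop. 3.4, Ex. 3.7, Prop. 5.1]
[cite: MoonenZarhin1999LowDim, §2] -/
theorem isOfCMType_of_mtRank_hodge_one_le_three (hX : IsSmoothProjective n X.X)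
    (h3 : haveI := BettiUniverse.finite hX 1
      (BettiUniverse.hodge exists_isReal_hodgeModel_holds hX 1).mtRank ≤ 3) :
    IsOfCMType X := by
  haveI := BettiUniverse.finite hX 1
  exact isOfCMType_of_mumfordTateLieAlgebra_le_endAlg hX
    (mumfordTateLieAlgebra_le_endAlg_of_mtRank_le_three _ (by norm_num) h3)

/-- **A complex abelian variety which is NOT of CM type has `dim MT(H¹(X)) ≥ 4`** — improving gen 28's
`three_le_mtRank_hodge_one_of_not_isOfCMType`; sharp, since `MT(H¹(E^g)) = GL₂` has dimension `4` for a non-CM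
elliptic curve `E`. [cite: MoonenZarhin1999LowDim, §2] [cite: Deligne1982HodgeCycles, I Ex. 3.7 and Prop. 5.1] -/
theorem four_le_mtRank_hodge_one_of_not_isOfCMType (hX : IsSmoothProjective n X.X) (hcm : ¬ IsOfCMType X) :
    haveI := BettiUniverse.finite hX 1
    4 ≤ (BettiUniverse.hodge exists_isReal_hodgeModel_holds hX 1).mtRank := by
  by_contra h
  exact hcm (isOfCMType_of_mtRank_hodge_one_le_three hX (by push Not at h; omega))

/-- **`dim MT(H¹(X)) = 3` ⟹ `X` is of CM type.** [cite: MoonenZarhin1999LowDim, §2] [cite: Deligne1982HodgeCycles, I Prop. 5.1] -/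
theorem isOfCMType_of_mtRank_hodge_one_eq_three (hX : IsSmoothProjective n X.X)
    (h3 : haveI := BettiUniverse.finite hX 1
      (BettiUniverse.hodge exists_isReal_hodgeModel_holds hX 1).mtRank = 3) :
    IsOfCMType X :=
  isOfCMType_of_mtRank_hodge_one_le_three hX h3.le

end RankThree

/-! ## §3 The rank-`3` rung: reduced dimension `2` -/

section Classification

variable [HodgeTensorFacts.{0, 0}] {X : AbelianVariety ℂ} {n : ℕ}

/-- **`dim MT(H¹(X)) = 3` iff `X` is isogenous to a product of copies of simple, pairwise non-isogenous CM abelian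
varieties of total dimension `2`** (`0 < dim X`) — i.e. of copies of ONE simple CM surface, or of TWO non-isogenous
CM elliptic curves.  `⟹`: `X` is of CM type (§2) and gen 28's `exists_sum_dim_eq_two_of_mtRank_hodge_one_eq_three`;
`⟸`: Ribet's bound `4 · Σ_c dim A'_c ≤ 2^{dim MT}` (`four_mul_sum_dim_le_two_pow_mtRank_hodge_one`) gives `dim MT ≥ 3`,
and `dim MT ≤ Σ_c dim A'_c + 1 = 3` (`mtRank_hodge_one_le_sum_dim_add_one_of_isIsogenous_biproduct`).
[cite: Gordon1999HodgeAVSurvey, 7.4–7.7] [cite: Dodson1987, Thm. 1.0 (iii)] [cite: MoonenZarhin1999LowDim, §2] -/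
theorem mtRank_hodge_one_eq_three_iff (hX : IsSmoothProjective n X.X) (h0 : 0 < X.dim) :
    haveI := BettiUniverse.finite hX 1
    (BettiUniverse.hodge exists_isReal_hodgeModel_holds hX 1).mtRank = 3 ↔
      ∃ (C : Type) (_ : Fintype C) (K' : C → Type) (_ : ∀ c, Field (K' c)) (_ : ∀ c, NumberField (K' c))
        (_ : ∀ c, IsCMField (K' c)) (Φ' : ∀ c, CMType (K' c)) (A' : C → AbelianVariety ℂ)
        (ι' : ∀ c, 𝓞 (K' c) →+* End (A' c)) (θ' : ∀ c, K' c →+* Module.End ℂ (complexBetti (A' c).X 1))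
        (m : ℕ) (cls : Fin (m + 1) → C) (f : X ⟶ ⨁ fun i => A' (cls i)),
        (∀ c, IsCMTypeRealisation (Φ' c) (A' c) (ι' c) (θ' c)) ∧ (∀ c, (A' c).IsSimple) ∧
        (∀ c c', c ≠ c' → ¬ IsIsogenous (A' c) (A' c')) ∧ Function.Surjective cls ∧ IsIsogeny f ∧
        ∑ c, (A' c).dim = 2 := by
  haveI := BettiUniverse.finite hX 1
  refine ⟨fun h3 => exists_sum_dim_eq_two_of_mtRank_hodge_one_eq_three hX h0
      (isOfCMType_of_mtRank_hodge_one_eq_three hX h3) h3, ?_⟩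
  rintro ⟨C, _, K', _, _, _, Φ', A', ι', θ', m, cls, f, hA, hs, hniso, hcls, hf, hsum⟩
  haveI : Nonempty C := ⟨cls 0⟩
  have hrib := four_mul_sum_dim_le_two_pow_mtRank_hodge_one hA hs hniso hcls hX ⟨f, hf⟩
  have hle := mtRank_hodge_one_le_sum_dim_add_one_of_isIsogenous_biproduct hA hcls hX ⟨f, hf⟩
  rw [hsum] at hrib hle
  set t := (BettiUniverse.hodge exists_isReal_hodgeModel_holds hX 1).mtRank with ht
  -- `8 ≤ 2^t` with `t ≤ 3` forces `t = 3`
  have h3t : 3 ≤ t := by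
    by_contra hlt
    have : 2 ^ t ≤ 2 ^ 2 := Nat.pow_le_pow_right (by norm_num) (by omega)
    omega
  omega

/-- **`X ∼ S^{N+1}` for a simple CM abelian SURFACE `S` ⟹ `dim MT(H¹(X)) = 3`** (`dim MT(H¹(S)) = dim S + 1 = 3`: simple CM
abelian varieties of dimension `≤ 3` are nondegenerate, `mtRank_hodge_one_eq_of_dim_le_three`; powers do not change
the Mumford–Tate group, `mtRank_hodge_one_eq_cmFamilyRank_of_isIsogenous_biproduct` with a constant family).
[cite: Gordon1999HodgeAVSurvey, 7.6.1 and 9.1] [cite: MoonenZarhin1999LowDim, §2] -/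
theorem mtRank_hodge_one_eq_three_of_isIsogenous_powSucc_surface (hX : IsSmoothProjective n X.X) {S : AbelianVariety ℂ}
    (hS : S.IsSimple) (hS2 : S.dim = 2) (hScm : IsOfCMType S) {N : ℕ} (hXS : IsIsogenous X (S.powSucc N)) :
    haveI := BettiUniverse.finite hX 1
    (BettiUniverse.hodge exists_isReal_hodgeModel_holds hX 1).mtRank = 3 := by
  have hS' := AbelianVariety.isSmoothProjective_holds (A := S)
  obtain ⟨K, _, _, _, Φ, S', ι, θ, s₀, hA, hiso, hK, -, hmt⟩ :=
    exists_realisation_mtRank_eq hS' hS (by omega) hScm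
  have h3 : cmTypeRank Φ = 3 := by
    rw [← hmt, mtRank_hodge_one_eq_of_dim_le_three hS' hS (by omega) (by omega) hScm, hS2]
  have hXB : IsIsogenous X (⨁ fun _ : Fin (N + 1) => S') :=
    hXS.trans ((isIsogenous_powSucc hiso N).trans (isIsogenous_powSucc_biproduct S' N))
  rw [mtRank_hodge_one_eq_cmFamilyRank_of_isIsogenous_biproduct (C := Unit) (K' := fun _ => K)
      (Φ' := fun _ => Φ) (A' := fun _ => S') (ι' := fun _ => ι) (θ' := fun _ => θ) (cls := fun _ : Fin (N + 1) => ())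
      (fun _ => hA) (fun u => ⟨0, Subsingleton.elim _ _⟩) hX hXB,
    cmFamilyRank_const_eq_cmTypeRank, h3]

/-- **`X ∼ ∏_c E_c^{m_c}` (all `m_c ≥ 1`) for pairwise non-isogenous CM elliptic curves `E_c` ⟹ `dim MT(H¹(X)) = #C + 1`**:
the family of their CM types (on imaginary quadratic fields) is separating, hence nondegenerate
(`isNondegenerateFamily_of_finrank_eq_two`, Artin independence of the sign characters), so
`dim MT = Σ_c dim E_c + 1` (`isNondegenerateFamily_iff_mtRank_hodge_one_eq`).  Two curves give the rank-`3` rung, one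
curve gen 28's rank-`2` rung. [cite: Gordon1999HodgeAVSurvey, 7.5 and 7.6.1] [cite: MoonenZarhin1999LowDim, §2] -/
theorem mtRank_hodge_one_eq_card_add_one_of_isIsogenous_biproduct_elliptic {C : Type} [Fintype C]
    {E : C → AbelianVariety ℂ} (hE1 : ∀ c, (E c).dim = 1) (hEcm : ∀ c, IsOfCMType (E c))
    (hniso : ∀ c c', c ≠ c' → ¬ IsIsogenous (E c) (E c')) {m : ℕ} {cls : Fin (m + 1) → C}
    (hcls : Function.Surjective cls) (hX : IsSmoothProjective n X.X) (hXE : IsIsogenous X (⨁ fun j => E (cls j))) :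
    haveI := BettiUniverse.finite hX 1
    (BettiUniverse.hodge exists_isReal_hodgeModel_holds hX 1).mtRank = Fintype.card C + 1 := by
  classical
  haveI : Nonempty C := ⟨cls 0⟩
  -- realisations `E' c ∼ E c` of CM types `Φ c` on imaginary quadratic fields `K c`
  have hreal := fun c => exists_realisation_mtRank_eq (AbelianVariety.isSmoothProjective_holds (A := E c))
    (isSimple_of_dim_le_one (hE1 c).le) (by rw [hE1 c]; exact one_pos) (hEcm c)
  choose K fK nfK cmK Φ E' ι θ s₀ hspec using hreal
  have hA : ∀ c, IsCMTypeRealisation (Φ c) (E' c) (ι c) (θ c) := fun c => (hspec c).1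
  have hiso : ∀ c, IsIsogenous (E c) (E' c) := fun c => (hspec c).2.1
  have hK : ∀ c, Module.finrank ℚ (K c) = 2 := fun c => by rw [(hspec c).2.2.1, hE1 c]
  have hdim : ∀ c, (E' c).dim = 1 := fun c => by rw [← (dim_eq_of_isIsogenous_holds (hiso c) : (E c).dim = (E' c).dim), hE1 c]
  have hs : ∀ c, (E' c).IsSimple := fun c => isSimple_of_dim_le_one (hdim c).le
  have hniso' : ∀ c c', c ≠ c' → ¬ IsIsogenous (E' c) (E' c') := fun c c' hcc' h =>
    hniso c c' hcc' (((hiso c).trans h).trans (hiso c').symm')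
  -- `X ∼ ⨁_j E'_{cls j}`
  choose g hg using fun j => hiso (cls j)
  have hXB : IsIsogenous X (⨁ fun j => E' (cls j)) := hXE.trans ⟨biproduct.map g, isIsogeny_biproduct_map hg⟩
  -- nondegenerate family ⟹ `dim MT = Σ_c dim E'_c + 1 = #C + 1`
  have hnd : CMAlgebra.IsNondegenerateFamily Φ :=
    isNondegenerateFamily_of_finrank_eq_two hK (CMAlgebra.isSeparatingFamily_of_isSimple_of_pairwise_not_isIsogenous hA hs hniso')
  rw [(isNondegenerateFamily_iff_mtRank_hodge_one_eq hA hcls hX hXB).1 hnd]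
  simp [hdim]

end Classification

/-! ## §4 The Hodge conjecture on all powers, for `dim MT(H¹(X)) ≤ 3` — no CM hypothesis -/

section HodgeConjecture

variable [HodgeTensorFacts.{0, 0}] {X : AbelianVariety ℂ} {n : ℕ}

/-- **`dim MT(H¹(X)) ≤ 3` ⟹ every power `X^{N+1}` is divisor-generated** (`0 < dim X`), for EVERY complex abelian variety:
`X` is of CM type (§2), and gen 28's `forall_isDivisorGenerated_powSucc_of_mtRank_hodge_one_le_three`.
[cite: Gordon1999HodgeAVSurvey, 7.4 and 7.5] [cite: Dodson1987, Thm. 1.0 (iii)] -/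
theorem isDivisorGenerated_powSucc_of_mtRank_hodge_one_le_three (hX : IsSmoothProjective n X.X) (h0 : 0 < X.dim)
    (h3 : haveI := BettiUniverse.finite hX 1
      (BettiUniverse.hodge exists_isReal_hodgeModel_holds hX 1).mtRank ≤ 3) (N : ℕ) :
    IsDivisorGenerated (X.powSucc N) :=
  forall_isDivisorGenerated_powSucc_of_mtRank_hodge_one_le_three hX h0
    (isOfCMType_of_mtRank_hodge_one_le_three hX h3) h3 N

/-- **The Hodge conjecture for every power of every complex abelian variety with `dim MT(H¹(X)) ≤ 3`** (`0 < dim X`),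
UNCONDITIONAL and without a CM hypothesis. [cite: Gordon1999HodgeAVSurvey, 7.5 and 9.1] [cite: MoonenZarhin1999LowDim, §2] -/
theorem hodgeConjectureFor_powSucc_of_mtRank_le_three (hX : IsSmoothProjective n X.X) (h0 : 0 < X.dim)
    (h3 : haveI := BettiUniverse.finite hX 1
      (BettiUniverse.hodge exists_isReal_hodgeModel_holds hX 1).mtRank ≤ 3) (N : ℕ) :
    HodgeConjectureFor (X.powSucc N).dim (X.powSucc N).X :=
  hodgeConjectureFor_of_isDivisorGenerated _ (isDivisorGenerated_powSucc_of_mtRank_hodge_one_le_three hX h0 h3 N)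

end HodgeConjecture

section InstanceFree

/-- Instance-free form (the tensor facts discharged by `hodgeTensorFacts_holds`): **`dim MT(H¹(X)) ≤ 3` ⟹ `X` is of CM
type, every power `X^{N+1}` is divisor-generated and satisfies the Hodge conjecture.** [cite: Gordon1999HodgeAVSurvey, 7.5]
[cite: MoonenZarhin1999LowDim, §2] -/
theorem hodgeConjectureFor_powSucc_of_mtRank_le_three' {X : AbelianVariety ℂ} {n : ℕ}
    (hX : IsSmoothProjective n X.X) (h0 : 0 < X.dim)
    (h3 : haveI := BettiUniverse.finite hX 1
      @HodgeStructure.mtRank _ _ _ hodgeTensorFacts_holds.{0, 0} _ _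
        (BettiUniverse.hodge exists_isReal_hodgeModel_holds hX 1) ≤ 3) (N : ℕ) :
    IsOfCMType X ∧ IsDivisorGenerated (X.powSucc N) ∧ HodgeConjectureFor (X.powSucc N).dim (X.powSucc N).X := by
  haveI : HodgeTensorFacts.{0, 0} := hodgeTensorFacts_holds.{0, 0}
  exact ⟨isOfCMType_of_mtRank_hodge_one_le_three hX h3,
    isDivisorGenerated_powSucc_of_mtRank_hodge_one_le_three hX h0 h3 N,
    hodgeConjectureFor_powSucc_of_mtRank_le_three hX h0 h3 N⟩

end InstanceFree

/-! ## §5 Class-target display (`Ring2.ClassTargets.HCOnClass`) -/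

section ClassTargets

open Summit.HodgeConjecture.HodgeConjecture.Ring2.ClassTargets (HCOnClass)

/-- **Class-target display**: the Hodge conjecture holds on the class of complex abelian varieties `B` with `0 < dim B`
and `dim MT(H¹(B)) ≤ 3` — UNCONDITIONAL, NO CM hypothesis (gen 28's `hcOnClass_isOfCMType_mtRank_hodge_one_le_three`
with the CM hypothesis removed). [cite: Gordon1999HodgeAVSurvey, 7.5 and 10.10] [cite: Deligne2000, §1] -/
theorem hcOnClass_mtRank_hodge_one_le_three :
    HCOnClass fun B => 0 < B.dim ∧
      @HodgeStructure.mtRank _ _ _ hodgeTensorFacts_holds.{0, 0}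
          (BettiUniverse.finite (AbelianVariety.isSmoothProjective_holds (A := B)) 1) _
          (BettiUniverse.hodge exists_isReal_hodgeModel_holds (AbelianVariety.isSmoothProjective_holds (A := B)) 1) ≤ 3 :=
  fun _ ⟨h0, h3⟩ =>
    (hodgeConjectureFor_powSucc_of_mtRank_le_three' AbelianVariety.isSmoothProjective_holds h0 h3 0).2.2

end ClassTargets

end Summit.HodgeConjecture.CorCM

end
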